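import Literature.NumberTheory.GaloisRepresentations.DecompositionGroupRelSlim
import Literature.AnabelianGeometry.AbsoluteAnabelian.GaloisSubextensionProofs
import Mathlib.Topology.Algebra.ClopenNhdofOne
import HarnessLib

/-!
# The global finite Galois layers are COFINAL in the local Galois group: every open subgroup of `Γ_{K_v}` contains
# `res⁻¹(Gal(K̄/E))` for a finite Galois `E/K` (Neukirch, *ANT* II (9.6), (8.2); Milne *ADT* I Lemma 4.13's limit over layers)

Topic `NumberTheory/GaloisRepresentations`; namespace `Literature.NumberTheory.GaloisRepresentations`.  Theorems only (no
definition, no named fact, no instance, no notation, no `sorry`); number fields in `Type`.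

For a number field `K`, a finite place `v`, `K_v = v.adicCompletion K` and the restriction
`res = absGaloisRestrict K K_v : Γ_{K_v} → Γ_K` (continuous, INJECTIVE — the tree's
`absGaloisRestrict_adicCompletion_injective`, Neukirch II (9.6) `G(L_w|K_v) ⥲ G_w(L|K)`), the finite Galois extensions
`E_w = E·K_v` of `K_v` coming from the finite Galois `E/K` are cofinal among all finite extensions of `K_v` inside `\bar K_v`:
in Galois terms,

* **`exists_galoisLayer_restrict_mem_fixingSubgroup_imp_mem`**: for every OPEN subgroup `U ≤ Γ_{K_v}` there is a finite Galois
  `E ⊆ K̄` over `K` such that `res σ ∈ Gal(K̄/E) ⟹ σ ∈ U` for all `σ ∈ Γ_{K_v}` (`res⁻¹(Γ_E) ≤ U`).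

Proof: `res` is a closed embedding (continuous injective, compact source, Hausdorff target), so `U = res⁻¹(V)` for an open
`V ⊆ Γ_K`; `V ∋ 1` contains an open normal subgroup `W` (profinite `Γ_K`, Mathlib
`exist_openNormalSubgroup_sub_open_nhds_of_one`), and `W = Gal(K̄/E)` for a finite Galois `E` (the tree's
`exists_intermediateField_of_isOpen_absoluteGaloisGroup`, infinite Galois theory).

HONEST FRAMING: classical; no case of BSD / Poitou–Tate.  Written for Route A (A3) of crux `AnticycControlAdditiveK` (cell
bsd-schneider): the local factor of Milne I Lemma 4.13 reads `H^r(K_v, M)` as the colimit over finite layers of `Γ_{K_v}`;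
this lemma says the colimit may be taken over the GLOBAL layers `E/K` (door-c5's `Hⁿ(Gal(E/F), ∏_{w∣v} E_wˣ) ≅ Hⁿ(Gal(E_w/F_v), E_wˣ)`),
the system door-c4's (d) runs over.

## References
* J. Neukirch, *Algebraic Number Theory*, Grundlehren 322 (1999), Ch. II §8 (8.2)–(8.3), §9 Prop. (9.6). [NeukirchANT1999]
* J. S. Milne, *Arithmetic Duality Theorems*, 2nd ed. (2006), Ch. I Lemma 4.13. [MilneADT2006]
* J.-P. Serre, *Cohomologie galoisienne*, LNM 5 (5th ed. 1994/1997), II §1.1 (cofinal systems of open subgroups). [SerreGaloisCohomology1997]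
-/

noncomputable section

open scoped NumberField
open Field IsDedekindDomain Function

namespace Literature.NumberTheory.GaloisRepresentations

variable (K : Type) [Field K] [NumberField K] (v : HeightOneSpectrum (𝓞 K))

/-- **`res : Γ_{K_v} → Γ_K` is a closed embedding** (continuous, injective, compact source, Hausdorff target).
[cite: NeukirchANT1999, Ch. II §9 Prop. (9.6)] -/
theorem isClosedEmbedding_absGaloisRestrict_adicCompletion :
    Topology.IsClosedEmbedding (absGaloisRestrict K (v.adicCompletion K)) := by
  haveI : CharZero (v.adicCompletion K) :=
    charZero_of_injective_algebraMap (algebraMap K (v.adicCompletion K)).injective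
  exact (absGaloisRestrict K (v.adicCompletion K)).continuous.isClosedEmbedding
    (absGaloisRestrict_adicCompletion_injective K v)

/-- **Every open subset of `Γ_{K_v}` is the preimage of an open subset of `Γ_K`** (`res` induces the topology).
[cite: NeukirchANT1999, Ch. II §9 Prop. (9.6)] -/
theorem exists_isOpen_preimage_absGaloisRestrict_eq {U : Set (absoluteGaloisGroup (v.adicCompletion K))} (hU : IsOpen U) :
    ∃ V : Set (absoluteGaloisGroup K), IsOpen V ∧ absGaloisRestrict K (v.adicCompletion K) ⁻¹' V = U :=
  (isClosedEmbedding_absGaloisRestrict_adicCompletion K v).isInducing.isOpen_iff.1 hU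

/-- **The global finite Galois layers are cofinal in `Γ_{K_v}`**: for every open subgroup `U ≤ Γ_{K_v}` there is a finite
Galois `E ⊆ K̄` over `K` with `res⁻¹(Gal(K̄/E)) ≤ U`, i.e. `res σ ∈ Gal(K̄/E) → σ ∈ U` — every finite extension of `K_v`
inside `\bar K_v` lies in the completion-compositum `E·K_v` of a finite Galois `E/K`.
[cite: NeukirchANT1999, Ch. II §8 (8.2)–(8.3), §9 Prop. (9.6)][cite: MilneADT2006, Ch. I Lemma 4.13] -/
theorem exists_galoisLayer_restrict_mem_fixingSubgroup_imp_mem (U : Subgroup (absoluteGaloisGroup (v.adicCompletion K)))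
    (hU : IsOpen (U : Set (absoluteGaloisGroup (v.adicCompletion K)))) :
    ∃ E : IntermediateField K (AlgebraicClosure K), FiniteDimensional K E ∧ IsGalois K E ∧
      ∀ σ : absoluteGaloisGroup (v.adicCompletion K),
        absoluteGaloisGroup.toAlgEquiv K (absGaloisRestrict K (v.adicCompletion K) σ) ∈ E.fixingSubgroup → σ ∈ U := by
  obtain ⟨V, hV, hVU⟩ := exists_isOpen_preimage_absGaloisRestrict_eq K v hU
  have h1 : (1 : absoluteGaloisGroup K) ∈ V := by
    have h : (1 : absoluteGaloisGroup (v.adicCompletion K)) ∈ absGaloisRestrict K (v.adicCompletion K) ⁻¹' V := by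
      rw [hVU]; exact U.one_mem
    rwa [Set.mem_preimage, map_one] at h
  obtain ⟨W, hW⟩ := ProfiniteGrp.exist_openNormalSubgroup_sub_open_nhds_of_one hV h1
  obtain ⟨E, hfd, hgal, hE⟩ :=
    Literature.AnabelianGeometry.AbsoluteAnabelian.exists_intermediateField_of_isOpen_absoluteGaloisGroup K
      (W : Subgroup (absoluteGaloisGroup K)) W.isOpen
  refine ⟨E, hfd, hgal inferInstance, fun σ hσ => ?_⟩
  have hmem : absGaloisRestrict K (v.adicCompletion K) σ ∈ (W : Subgroup (absoluteGaloisGroup K)) := by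
    rw [← hE]
    exact hσ
  have hV' : σ ∈ absGaloisRestrict K (v.adicCompletion K) ⁻¹' V := hW hmem
  rwa [hVU] at hV'

end Literature.NumberTheory.GaloisRepresentations

end
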